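import Literature.AnabelianGeometry.EtaleTheta.DivisorMonoidsOfGaloisCovering

/-!
# [EtTh] Def. 3.3 (iii), step 3: restriction of Def. 3.3 (iii) data to a full subcategory, and the data of the
# CONNECTED coverings dominated by one universal combinatorial covering (`D₀` proper)

S. Mochizuki, *The étale theta function …*, Publ. RIMS **45** (2009) [MochizukiEtTh2009], §3, p.72
"`D₀ := B^temp(X^log)⁰` … where the superscript '0' denotes the full subcategory constituted by the connected
objects", and Def. 3.3 (iii) p.73 ("for any connected tempered covering `Y^log → X^log` …")
[cite: MochizukiEtTh2009, Def 3.3 p.73].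

CLASS (b) CONSTRUCTION (abc-iut cell; the frozen `DivisorMonoids` (`DivisorMonoids.lean`) and the landed
`DivisorMonoids.ofGaloisAction` (`DivisorMonoidsOfGaloisCovering.lean`) are consumed BY NAME):

* `DivisorMonoids.restrict T P` — the Def. 3.3 (iii) data `T` over `D₀` restricted to the full subcategory cut
  out by an object property `P` (all fields whiskered along the inclusion `P.ι`; general and reusable);
* `GaloisAction.isConnectedGSet` — the object property "nonempty and transitive" on the `G`-sets
  `Action (Type u) G`, `G = Gal(Z^log_∞/X^log)`: the CONNECTED coverings of `X^log` dominated by `Z^log_∞`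
  (`S = G/H`), i.e. Def. 3.3's `D₀` at this term of the inductive limit; in it every morphism is SURJECTIVE
  (`hom_surjective_of_isConnectedGSet`) and every monomorphism is INJECTIVE (`hom_injective_of_mono`, probing
  from the regular `G`-set `G/1`), as for connected objects of a Galois category;
* `DivisorMonoids.ofGaloisActionConnected A hZ := (ofGaloisAction A hZ).restrict isConnectedGSet` — the
  Def. 3.3 (iii) data over `D₀` proper — with the THEOREMS that its transition maps are injective
  (`ofGaloisActionConnected_B₀_map_injective`, `…_Φ₀_map_injective`: the v-next law field `B₀_map_injective` /
  `Φ₀_map_injective` asked for in GAP row G-w5d179-1 — "the transition maps of `B₀`, `Φ₀` are inclusions of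
  invariants inside one direct system" — HOLDS at this data) and bijective along monomorphisms
  (`…_Φ₀_map_bijective_of_mono`, the [FrdI] Def. 1.1 (ii)(b) shape).
No named Prop fact, no instance, no sorry.  HONEST FRAMING: a construction over typed interfaces; nothing here
bears on [IUTchIII] Cor. 3.12; typed ≠ proved.
-/

namespace Literature.AnabelianGeometry.EtaleTheta

open CategoryTheory Opposite Literature.AlgebraicGeometry.Frobenioids

universe u v w

/-! ## Restriction of Def. 3.3 (iii) data to a full subcategory -/

namespace DivisorMonoids

variable {D₀ : Type u} [Category.{v} D₀] (T : DivisorMonoids.{u, v, w} D₀) (P : ObjectProperty D₀)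

/-- **Restriction of the Def. 3.3 (iii) data to a full subcategory** `P.FullSubcategory ⊆ D₀`: every functor
and transformation whiskered along the (fully faithful) inclusion `P.ι`. [cite: MochizukiEtTh2009, Def 3.3 p.73] -/
noncomputable def restrict : DivisorMonoids.{u, v, w} P.FullSubcategory where
  Φ₀ := P.ι.op ⋙ T.Φ₀
  B₀ := P.ι.op ⋙ T.B₀
  isUnit_B₀ Y b := T.isUnit_B₀ (op Y.unop.obj) b
  div₀ Y := T.div₀ (op Y.unop.obj)
  div₀_natural f b := T.div₀_natural f.unop.hom.op b
  F₀ Y := T.F₀ (op Y.unop.obj)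
  F₀_map f b hb := T.F₀_map f.unop.hom.op b hb
  ncsp₀ Y := T.ncsp₀ (op Y.unop.obj)
  csp₀ Y := T.csp₀ (op Y.unop.obj)
  ncsp₀_map f x hx := T.ncsp₀_map f.unop.hom.op x hx
  csp₀_map f x hx := T.csp₀_map f.unop.hom.op x hx
  existsUnique_ncsp_csp Y x := T.existsUnique_ncsp_csp (op Y.unop.obj) x

/-- `Φ₀` of the restriction, on objects. [cite: MochizukiEtTh2009, Def 3.3 p.73] -/
theorem restrict_Φ₀_obj (Y : (P.FullSubcategory)ᵒᵖ) : (T.restrict P).Φ₀.obj Y = T.Φ₀.obj (op Y.unop.obj) := rfl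

/-- `B₀` of the restriction, on objects. [cite: MochizukiEtTh2009, Def 3.3 p.73] -/
theorem restrict_B₀_obj (Y : (P.FullSubcategory)ᵒᵖ) : (T.restrict P).B₀.obj Y = T.B₀.obj (op Y.unop.obj) := rfl

/-- `Φ₀` of the restriction, on morphisms. [cite: MochizukiEtTh2009, Def 3.3 p.73] -/
theorem restrict_Φ₀_map {Y Y' : (P.FullSubcategory)ᵒᵖ} (f : Y ⟶ Y') :
    (T.restrict P).Φ₀.map f = T.Φ₀.map f.unop.hom.op := rfl

/-- `B₀` of the restriction, on morphisms. [cite: MochizukiEtTh2009, Def 3.3 p.73] -/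
theorem restrict_B₀_map {Y Y' : (P.FullSubcategory)ᵒᵖ} (f : Y ⟶ Y') :
    (T.restrict P).B₀.map f = T.B₀.map f.unop.hom.op := rfl

/-- `div₀` of the restriction. [cite: MochizukiEtTh2009, Def 3.3 p.73] -/
theorem restrict_div₀ (Y : (P.FullSubcategory)ᵒᵖ) : (T.restrict P).div₀ Y = T.div₀ (op Y.unop.obj) := rfl

/-- `F₀` of the restriction. [cite: MochizukiEtTh2009, Def 3.3 p.73] -/
theorem restrict_F₀ (Y : (P.FullSubcategory)ᵒᵖ) : (T.restrict P).F₀ Y = T.F₀ (op Y.unop.obj) := rfl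

/-- Prop. 3.4 (ii)'s typed fields descend to any restriction. [cite: MochizukiEtTh2009, Prop 3.4 p.74] -/
theorem restrict_prop34_ii (hker : ∀ (Y : D₀ᵒᵖ) (b : T.B₀.obj Y), T.div₀ Y b = 1 → b ∈ T.F₀ Y)
    (heff : ∀ (Y : D₀ᵒᵖ) (b : T.B₀.obj Y) (x : T.Φ₀.obj Y),
      T.div₀ Y b = Algebra.GrothendieckGroup.of x → b ∈ T.F₀ Y) :
    (∀ (Y : (P.FullSubcategory)ᵒᵖ) (b : (T.restrict P).B₀.obj Y), (T.restrict P).div₀ Y b = 1 →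
        b ∈ (T.restrict P).F₀ Y) ∧
      ∀ (Y : (P.FullSubcategory)ᵒᵖ) (b : (T.restrict P).B₀.obj Y) (x : (T.restrict P).Φ₀.obj Y),
        (T.restrict P).div₀ Y b = Algebra.GrothendieckGroup.of x → b ∈ (T.restrict P).F₀ Y :=
  ⟨fun _ b h => hker _ b h, fun _ b x h => heff _ b x h⟩

end DivisorMonoids

/-! ## The connected coverings dominated by `Z^log_∞`: nonempty transitive `G`-sets -/

namespace LogDivisorModel.GaloisAction

variable {G : Type u} [Group G]

/-- **Def. 3.3's `D₀` at one term of the limit**: the object property "connected" — nonempty and transitive —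
on the `G`-sets (`S = G/H` for `H = Gal(Z^log_∞/Y^log)` the stabiliser of a point).
[cite: MochizukiEtTh2009, Def 3.3 p.73] -/
def isConnectedGSet : ObjectProperty (Action (Type u) G) :=
  fun S => Nonempty S.V ∧ ∀ s t : S.V, ∃ g : G, S.ρ g s = t

/-- Membership in `isConnectedGSet`. [cite: MochizukiEtTh2009, Def 3.3 p.73] -/
theorem isConnectedGSet_iff (S : Action (Type u) G) :
    isConnectedGSet S ↔ Nonempty S.V ∧ ∀ s t : S.V, ∃ g : G, S.ρ g s = t := Iff.rfl

/-- The regular `G`-set `G/1` (= `Z^log_∞` itself) is connected. [cite: MochizukiEtTh2009, Def 3.3 p.73] -/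
theorem isConnectedGSet_leftRegular : isConnectedGSet (Action.leftRegular G) := by
  refine ⟨⟨(1 : G)⟩, fun s t => ?_⟩
  change G at s t
  exact ⟨t * s⁻¹, by rw [Action.ofMulAction_apply, smul_eq_mul, inv_mul_cancel_right]⟩

/-- The coset `G`-set `G/H` (the covering `Y^log` with `Gal(Z^log_∞/Y^log) = H`) is connected.
[cite: MochizukiEtTh2009, Def 3.3 p.73] -/
theorem isConnectedGSet_quotient (H : Subgroup G) : isConnectedGSet (Action.ofMulAction G (G ⧸ H)) := by
  refine ⟨⟨((1 : G) : G ⧸ H)⟩, fun s t => ?_⟩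
  induction s using QuotientGroup.induction_on with
  | H a =>
    induction t using QuotientGroup.induction_on with
    | H b => exact ⟨b * a⁻¹, by
        rw [Action.ofMulAction_apply, MulAction.Quotient.smul_coe, smul_eq_mul, inv_mul_cancel_right]⟩

/-- **Covering maps between connected coverings are surjective.** [cite: MochizukiEtTh2009, Def 3.3 p.73] -/
theorem hom_surjective_of_isConnectedGSet {S S' : Action (Type u) G} (hS : isConnectedGSet S)
    (hS' : isConnectedGSet S') (f : S ⟶ S') : Function.Surjective f.hom :=
  hom_surjective_of_transitive f hS.1 hS'.2

/-- The orbit map `G/1 → S`, `g ↦ g · s`, a morphism from the regular `G`-set (probe used for monomorphisms).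
[cite: MochizukiEtTh2009, Def 3.3 p.73] -/
def orbitHom (S : Action (Type u) G) (s : S.V) : Action.leftRegular G ⟶ S where
  hom := TypeCat.ofHom fun g : G => S.ρ g s
  comm g := by
    refine ConcreteCategory.hom_ext _ _ fun x => ?_
    change S.ρ ((Action.leftRegular G).ρ g x) s = S.ρ g (S.ρ x s)
    rw [Action.ofMulAction_apply, smul_eq_mul, map_mul]
    rfl

/-- The orbit map sends `g` to `g · s`. [cite: MochizukiEtTh2009, Def 3.3 p.73] -/
@[simp] theorem orbitHom_apply (S : Action (Type u) G) (s : S.V) (g : G) : (orbitHom S s).hom g = S.ρ g s := rfl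

/-- **A monomorphism between connected coverings is injective** (probe by the two orbit maps from `G/1`), as for
connected objects of a Galois category; hence — being surjective — bijective. [cite: MochizukiEtTh2009, Def 3.3 p.73] -/
theorem hom_injective_of_mono {X Y : (isConnectedGSet (G := G)).FullSubcategory} (f : X ⟶ Y) [Mono f] :
    Function.Injective f.hom.hom := by
  intro x₁ x₂ h
  let φ₁ : (⟨Action.leftRegular G, isConnectedGSet_leftRegular⟩ : (isConnectedGSet (G := G)).FullSubcategory) ⟶ X :=
    ObjectProperty.homMk (orbitHom X.obj x₁)
  let φ₂ : (⟨Action.leftRegular G, isConnectedGSet_leftRegular⟩ : (isConnectedGSet (G := G)).FullSubcategory) ⟶ X :=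
    ObjectProperty.homMk (orbitHom X.obj x₂)
  have hcomp : φ₁ ≫ f = φ₂ ≫ f := by
    refine ObjectProperty.hom_ext _ (Action.hom_ext _ _ (ConcreteCategory.hom_ext _ _ fun g => ?_))
    change f.hom.hom ((orbitHom X.obj x₁).hom g) = f.hom.hom ((orbitHom X.obj x₂).hom g)
    rw [orbitHom_apply, orbitHom_apply]
    have e₁ := congrFun (congrArg (fun φ : X.obj.V ⟶ Y.obj.V => (φ : X.obj.V → Y.obj.V)) (f.hom.comm g)) x₁
    have e₂ := congrFun (congrArg (fun φ : X.obj.V ⟶ Y.obj.V => (φ : X.obj.V → Y.obj.V)) (f.hom.comm g)) x₂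
    simp only [types_comp_apply] at e₁ e₂
    rw [e₁, e₂, h]
  have hφ : φ₁ = φ₂ := (cancel_mono f).mp hcomp
  have h1 := congrArg (fun φ : _ ⟶ X => (φ.hom.hom : (Action.leftRegular G).V → X.obj.V) (1 : G)) hφ
  change (orbitHom X.obj x₁).hom (1 : G) = (orbitHom X.obj x₂).hom (1 : G) at h1
  rw [orbitHom_apply, orbitHom_apply, map_one] at h1
  exact h1

/-- A monomorphism between connected coverings is bijective. [cite: MochizukiEtTh2009, Def 3.3 p.73] -/
theorem hom_bijective_of_mono {X Y : (isConnectedGSet (G := G)).FullSubcategory} (f : X ⟶ Y) [Mono f] :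
    Function.Bijective f.hom.hom :=
  ⟨hom_injective_of_mono f, hom_surjective_of_isConnectedGSet X.property Y.property f.hom⟩

variable {Z : LogDivisorModel.{u}} (A : Z.GaloisAction G)

/-- Pull-back of log-divisors along a BIJECTIVE covering map is bijective. [cite: MochizukiEtTh2009, Def 3.3 p.73] -/
theorem phiZeroPull_bijective {S S' : Action (Type u) G} (f : S ⟶ S') (hf : Function.Bijective f.hom) :
    Function.Bijective (A.phiZeroPull f) := by
  refine ⟨A.phiZeroPull_injective f hf.2, fun φ => ?_⟩
  obtain ⟨g, hgl, hgr⟩ := Function.bijective_iff_has_inverse.mp hf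
  have hg_equiv : ∀ (x : G) (t : S'.V), g (S'.ρ x t) = S.ρ x (g t) := fun x t => by
    apply hf.1
    rw [hgr]
    have := congrFun (congrArg (fun φ : S.V ⟶ S'.V => (φ : S.V → S'.V)) (f.comm x)) (g t)
    simp only [types_comp_apply] at this
    rw [this, hgr]
  refine ⟨⟨fun t => φ.1 (g t), fun t => φ.2.1 _, fun x t => by
    show φ.1 (g (S'.ρ x t)) = _
    rw [hg_equiv, φ.2.2]⟩, Subtype.ext (funext fun s => ?_)⟩
  show φ.1 (g (f.hom s)) = φ.1 s
  rw [hgl]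

end LogDivisorModel.GaloisAction

/-! ## The Def. 3.3 (iii) data over the connected coverings -/

namespace DivisorMonoids

variable {Z : LogDivisorModel.{u}} {G : Type u} [Group G] (A : Z.GaloisAction G) (hZ : Z.CuspLaws)

open LogDivisorModel.GaloisAction

/-- **Def. 3.3 (iii) data over `D₀` proper** — the CONNECTED coverings of `X^log` dominated by `Z^log_∞`
(nonempty transitive `G`-sets): the restriction of `ofGaloisAction A hZ`. [cite: MochizukiEtTh2009, Def 3.3 p.73] -/
noncomputable def ofGaloisActionConnected :
    DivisorMonoids.{u + 1, u, u} (isConnectedGSet (G := G)).FullSubcategory :=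
  (ofGaloisAction A hZ).restrict isConnectedGSet

/-- It IS the restriction (by definition). [cite: MochizukiEtTh2009, Def 3.3 p.73] -/
theorem ofGaloisActionConnected_eq :
    ofGaloisActionConnected A hZ = (ofGaloisAction A hZ).restrict isConnectedGSet := rfl

/-- **The transition maps of `B₀` are injective** over the connected coverings — the v-next law field
`B₀_map_injective` of GAP row G-w5d179-1 ("inclusions `Mero(Z_∞)^H ↪ Mero(Z_∞)^{H'}` inside one direct
system") HOLDS at this data. [cite: MochizukiEtTh2009, Def 3.3 p.73] -/
theorem ofGaloisActionConnected_B₀_map_injective {Y Y' : ((isConnectedGSet (G := G)).FullSubcategory)ᵒᵖ}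
    (f : Y ⟶ Y') : Function.Injective ((ofGaloisActionConnected A hZ).B₀.map f).hom :=
  A.bZeroPull_injective f.unop.hom
    (hom_surjective_of_isConnectedGSet Y'.unop.property Y.unop.property f.unop.hom)

/-- **The transition maps of `Φ₀` are injective** over the connected coverings (twin law `Φ₀_map_injective` of
G-w5d179-1; [FrdI] Def. 1.1 (ii)(a) injectivity of pull-backs). [cite: MochizukiEtTh2009, Def 3.3 p.73] -/
theorem ofGaloisActionConnected_Φ₀_map_injective {Y Y' : ((isConnectedGSet (G := G)).FullSubcategory)ᵒᵖ}
    (f : Y ⟶ Y') : Function.Injective ((ofGaloisActionConnected A hZ).Φ₀.map f).hom :=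
  A.phiZeroPull_injective f.unop.hom
    (hom_surjective_of_isConnectedGSet Y'.unop.property Y.unop.property f.unop.hom)

/-- Pull-back of log-divisors along a MONOMORPHISM of connected coverings is bijective ([FrdI] Def. 1.1 (ii)(b)
shape: FSM-morphisms — in particular monomorphisms — pull back to isomorphisms). [cite: MochizukiEtTh2009, Def 3.3 p.73] -/
theorem ofGaloisActionConnected_Φ₀_map_bijective_of_mono {Y' Y : (isConnectedGSet (G := G)).FullSubcategory}
    (f : Y' ⟶ Y) [Mono f] : Function.Bijective ((ofGaloisActionConnected A hZ).Φ₀.map f.op).hom :=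
  A.phiZeroPull_bijective f.hom (hom_bijective_of_mono f)

end DivisorMonoids

end Literature.AnabelianGeometry.EtaleTheta
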